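import Literature.Analysis.Fourier.BoasKacDefs

/-!
# Lattice step functions: cell decomposition, Fourier transform and `L²` norm

The discretisation layer of the Boas–Kac factorisation (sums of autocorrelations are autocorrelations,
`BoasKacFourierSide.lean`).  For a mesh `h > 0` and a polynomial `Q` (a container for finitely many cell
values) the LATTICE STEP FUNCTION is `latticeStep h Q x = Q_{⌊x/h⌋}` for `x ≥ 0` and `0` for `x < 0`: the
value `Q_k` on the cell `[kh, (k+1)h)`, zero left of `0` and right of `(natDegree Q + 1) h`.  We prove:

* the cell decomposition `∫ latticeStep h Q · φ = Σ_k Q_k ∫_{kh}^{(k+1)h} φ` (`integral_latticeStep_mul`);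
* the Fourier transform `𝓕 (latticeStep h Q) ξ = (∫₀ʰ e^{-2πiyξ} dy) · Q(z)`, `z = e^{-2πihξ}` on the unit
  circle (`fourier_latticeStep`), hence `|𝓕 (latticeStep h Q) ξ|² = |∫₀ʰ…|² · conj z^n · (Q · conjReverse n Q)(z)`
  (`normSq_fourier_latticeStep`) depends on `Q` only through `Q * conjReverse n Q` — the bridge to the
  Fejér–Riesz theorem;
* the `L²` norm `∫ |latticeStep h Q|² = h · Σ_k |Q_k|²` and `Σ_k |Q_k|² = Re (Q * conjReverse n Q)_n`
  (`integral_norm_sq_latticeStep`, `sum_norm_sq_coeff_eq_re_coeff`), `MemLp` / integrability / support facts;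
* sampling: `samplePoly h n g = Σ_{k ≤ n} g(kh) X^k`, and `latticeStep h (samplePoly h n g)` is uniformly
  `ω_g(h)`-close to a `g` supported in `[0, L]` with `L < (n+1)h` (`norm_latticeStep_samplePoly_sub_le`), so
  that its Fourier transform is `ω_g(h)·(L+1)`-close (`norm_fourier_sub_fourier_le`).

Everything is elementary bookkeeping over Mathlib's interval integrals.  [folklore]
-/

noncomputable section

open Polynomial Filter MeasureTheory Set FourierTransform
open _root_.Complex _root_.Real
open scoped ComplexConjugate ComplexOrder Topology

namespace Literature.Analysis.Fourier.LatticeStep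

open Literature.Analysis.Fourier.FejerRiesz

variable {h : ℝ} {n : ℕ} {Q : ℂ[X]}

/-! ## The lattice step function -/

/-- Left of `0` the lattice step function vanishes. [folklore] -/
theorem latticeStep_of_neg {x : ℝ} (hx : x < 0) : latticeStep h Q x = 0 := if_neg (not_le.mpr hx)

/-- On the cell `[kh, (k+1)h)` the lattice step function equals `Q_k`. [folklore] -/
theorem latticeStep_of_mem_Ico (hh : 0 < h) {k : ℕ} {x : ℝ} (hx : x ∈ Ico ((k : ℝ) * h) ((k + 1) * h)) :
    latticeStep h Q x = Q.coeff k := by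
  have hx0 : 0 ≤ x := le_trans (by positivity) hx.1
  have hk : ⌊x / h⌋₊ = k := by
    rw [Nat.floor_eq_iff (div_nonneg hx0 hh.le), le_div_iff₀ hh, div_lt_iff₀ hh]
    exact ⟨hx.1, hx.2⟩
  simp [latticeStep, hx0, hk]

/-- Right of `(n+1)h` (`natDegree Q ≤ n`) the lattice step function vanishes. [folklore] -/
theorem latticeStep_of_ge (hh : 0 < h) (hQ : Q.natDegree ≤ n) {x : ℝ} (hx : ((n : ℝ) + 1) * h ≤ x) :
    latticeStep h Q x = 0 := by
  have hx0 : 0 ≤ x := le_trans (by positivity) hx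
  have hfl : n + 1 ≤ ⌊x / h⌋₊ := Nat.le_floor (by rw [le_div_iff₀ hh]; exact_mod_cast hx)
  simp only [latticeStep, if_pos hx0]
  exact coeff_eq_zero_of_natDegree_lt (lt_of_le_of_lt hQ hfl)

/-- Outside `[0, (n+1)h)` the lattice step function vanishes. [folklore] -/
theorem latticeStep_eq_zero_of_not_mem (hh : 0 < h) (hQ : Q.natDegree ≤ n) {x : ℝ}
    (hx : x ∉ Ico 0 (((n : ℝ) + 1) * h)) : latticeStep h Q x = 0 := by
  rcases lt_or_ge x 0 with h1 | h1
  · exact latticeStep_of_neg h1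
  · exact latticeStep_of_ge hh hQ (not_lt.mp fun h2 => hx ⟨h1, h2⟩)

/-- Crude uniform bound: `|latticeStep h Q x| ≤ Σ_{k ≤ n} |Q_k|`. [folklore] -/
theorem norm_latticeStep_le (hQ : Q.natDegree ≤ n) (x : ℝ) :
    ‖latticeStep h Q x‖ ≤ ∑ k ∈ Finset.range (n + 1), ‖Q.coeff k‖ := by
  unfold latticeStep
  split_ifs with hx
  · by_cases hk : ⌊x / h⌋₊ ≤ n
    · exact Finset.single_le_sum (f := fun k => ‖Q.coeff k‖) (fun _ _ => norm_nonneg _)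
        (Finset.mem_range.mpr (Nat.lt_succ_of_le hk))
    · rw [coeff_eq_zero_of_natDegree_lt (lt_of_le_of_lt hQ (not_le.mp hk)), norm_zero]
      exact Finset.sum_nonneg fun _ _ => norm_nonneg _
  · rw [norm_zero]; exact Finset.sum_nonneg fun _ _ => norm_nonneg _

/-- The lattice step function is measurable. [folklore] -/
theorem measurable_latticeStep (h : ℝ) (Q : ℂ[X]) : Measurable (latticeStep h Q) := by
  unfold latticeStep
  refine Measurable.ite (measurableSet_le measurable_const measurable_id) ?_ measurable_const
  exact (measurable_from_nat (f := fun k : ℕ => Q.coeff k)).comp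
    (Nat.measurable_floor.comp (measurable_id.div_const h))

/-- The lattice step function is integrable. [folklore] -/
theorem integrable_latticeStep (hh : 0 < h) (hQ : Q.natDegree ≤ n) : Integrable (latticeStep h Q) := by
  set M : ℝ := ∑ k ∈ Finset.range (n + 1), ‖Q.coeff k‖
  refine Integrable.mono' (g := (Icc (0 : ℝ) (((n : ℝ) + 1) * h)).indicator fun _ => M) ?_
    (measurable_latticeStep h Q).aestronglyMeasurable (Eventually.of_forall fun x => ?_)
  · exact (integrableOn_const (measure_Icc_lt_top.ne)).integrable_indicator measurableSet_Icc
  · by_cases hx : x ∈ Ico (0 : ℝ) (((n : ℝ) + 1) * h)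
    · rw [indicator_of_mem (Ico_subset_Icc_self hx)]; exact norm_latticeStep_le hQ x
    · rw [latticeStep_eq_zero_of_not_mem hh hQ hx, norm_zero]; exact indicator_nonneg (fun _ _ => by positivity) _

/-! ## Cell decomposition of integrals -/

/-- An integral over `ℝ` of a function vanishing off `[0, (n+1)h)` is the sum of its cell integrals.
[folklore] -/
theorem integral_eq_sum_cells {E : Type*} [NormedAddCommGroup E] [NormedSpace ℝ E] (hh : 0 < h) (n : ℕ)
    {w : ℝ → E} (hw : ∀ x ∉ Ico (0 : ℝ) (((n : ℝ) + 1) * h), w x = 0)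
    (hint : ∀ k < n + 1, IntervalIntegrable w volume ((k : ℝ) * h) (((k : ℝ) + 1) * h)) :
    ∫ x, w x = ∑ k ∈ Finset.range (n + 1), ∫ x in ((k : ℝ) * h)..(((k : ℝ) + 1) * h), w x := by
  have hadj := intervalIntegral.sum_integral_adjacent_intervals (μ := volume) (f := w)
    (a := fun k : ℕ => (k : ℝ) * h) (n := n + 1) fun k hk => by
      have := hint k hk; push_cast; exact this
  push_cast at hadj
  rw [hadj, zero_mul, intervalIntegral.integral_of_le (by positivity), ← integral_Icc_eq_integral_Ioc,
    setIntegral_eq_integral_of_forall_compl_eq_zero fun x hx => hw x fun h' => hx (Ico_subset_Icc_self h')]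

/-- Interval integrals over a cell only see the open cell. [folklore] -/
theorem intervalIntegral_cell_congr {E : Type*} [NormedAddCommGroup E] [NormedSpace ℝ E] (hh : 0 < h)
    {k : ℕ} {u v : ℝ → E} (huv : ∀ x ∈ Ioo ((k : ℝ) * h) (((k : ℝ) + 1) * h), u x = v x) :
    ∫ x in ((k : ℝ) * h)..(((k : ℝ) + 1) * h), u x = ∫ x in ((k : ℝ) * h)..(((k : ℝ) + 1) * h), v x := by
  have hle : (k : ℝ) * h ≤ ((k : ℝ) + 1) * h := by nlinarith
  rw [intervalIntegral.integral_of_le hle, intervalIntegral.integral_of_le hle,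
    integral_Ioc_eq_integral_Ioo, integral_Ioc_eq_integral_Ioo]
  exact setIntegral_congr_fun measurableSet_Ioo huv

/-- **Cell decomposition.** `∫ latticeStep h Q · φ = Σ_{k ≤ n} Q_k ∫_{kh}^{(k+1)h} φ` for continuous `φ`.
[folklore] -/
theorem integral_latticeStep_mul (hh : 0 < h) (hQ : Q.natDegree ≤ n) {φ : ℝ → ℂ} (hφ : Continuous φ) :
    ∫ x, latticeStep h Q x * φ x =
      ∑ k ∈ Finset.range (n + 1), Q.coeff k * ∫ x in ((k : ℝ) * h)..(((k : ℝ) + 1) * h), φ x := by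
  rw [integral_eq_sum_cells hh n (w := fun x => latticeStep h Q x * φ x)]
  · refine Finset.sum_congr rfl fun k _ => ?_
    rw [← intervalIntegral.integral_const_mul]
    exact intervalIntegral_cell_congr hh fun x hx => by rw [latticeStep_of_mem_Ico hh ⟨hx.1.le, hx.2⟩]
  · intro x hx
    rw [latticeStep_eq_zero_of_not_mem hh hQ hx, zero_mul]
  · intro k _
    exact ((integrable_latticeStep hh hQ).intervalIntegrable).mul_continuousOn hφ.continuousOn

/-! ## Fourier transform -/

/-- **Fourier transform of a lattice step function**: `𝓕 (latticeStep h Q) ξ = (∫₀ʰ e^{-2πiyξ}dy) · Q(e^{-2πihξ})`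
(`natDegree Q ≤ n`). [folklore] -/
theorem fourier_latticeStep (hh : 0 < h) (hQ : Q.natDegree ≤ n) (ξ : ℝ) :
    𝓕 (latticeStep h Q) ξ = cellChar h ξ * Q.eval (latticePoint h ξ) := by
  rw [Real.fourier_real_eq]
  simp_rw [Circle.smul_def, Real.fourierChar_apply, smul_eq_mul]
  rw [show (fun v : ℝ => cexp (↑(2 * π * (-(v * ξ))) * I) * latticeStep h Q v) =
      fun v => latticeStep h Q v * cexp (↑(2 * π * (-(v * ξ))) * I) from funext fun v => mul_comm _ _]
  rw [integral_latticeStep_mul hh hQ (by fun_prop), eval_eq_sum_range' (Nat.lt_succ_of_le hQ), Finset.mul_sum]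
  refine Finset.sum_congr rfl fun k _ => ?_
  have hcell : ∫ x in ((k : ℝ) * h)..(((k : ℝ) + 1) * h), cexp (↑(2 * π * (-(x * ξ))) * I) =
      latticePoint h ξ ^ k * cellChar h ξ := by
    have hsub := intervalIntegral.integral_comp_add_right (a := 0) (b := h)
      (fun x => cexp (↑(2 * π * (-(x * ξ))) * I)) ((k : ℝ) * h)
    rw [zero_add, show h + (k : ℝ) * h = ((k : ℝ) + 1) * h by ring] at hsub
    rw [← hsub, cellChar, ← intervalIntegral.integral_const_mul]
    refine intervalIntegral.integral_congr fun x _ => ?_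
    simp only [latticePoint]
    rw [← Complex.exp_nat_mul, ← Complex.exp_add]
    congr 1
    push_cast
    ring
  rw [hcell]
  ring

/-- The squared modulus of the Fourier transform of a lattice step function, through the autocorrelation
polynomial `Q * conjReverse n Q`: `|𝓕 (latticeStep h Q) ξ|² = |∫₀ʰ…|² · conj z^n · (Q · conjReverse n Q)(z)`,
`z = e^{-2πihξ}`. [folklore] -/
theorem normSq_fourier_latticeStep (hh : 0 < h) (hQ : Q.natDegree ≤ n) (ξ : ℝ) :
    (normSq (𝓕 (latticeStep h Q) ξ) : ℂ) = (normSq (cellChar h ξ) : ℂ) *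
      (conj (latticePoint h ξ) ^ n * (Q * conjReverse n Q).eval (latticePoint h ξ)) := by
  rw [fourier_latticeStep hh hQ ξ, conj_pow_mul_eval_mul_conjReverse hQ (norm_latticePoint h ξ), normSq_mul,
    ofReal_mul]

/-! ## `L²` norm -/

/-- A lattice step function is in `L²`. [folklore] -/
theorem memLp_two_latticeStep (hh : 0 < h) (hQ : Q.natDegree ≤ n) : MemLp (latticeStep h Q) 2 volume := by
  refine (memLp_two_iff_integrable_sq_norm (measurable_latticeStep h Q).aestronglyMeasurable).mpr ?_
  set M : ℝ := ∑ k ∈ Finset.range (n + 1), ‖Q.coeff k‖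
  refine Integrable.mono' (g := (Icc (0 : ℝ) (((n : ℝ) + 1) * h)).indicator fun _ => M ^ 2) ?_
    ((measurable_latticeStep h Q).norm.pow_const 2).aestronglyMeasurable (Eventually.of_forall fun x => ?_)
  · exact (integrableOn_const (measure_Icc_lt_top.ne)).integrable_indicator measurableSet_Icc
  · rw [Real.norm_eq_abs, abs_pow, abs_norm]
    by_cases hx : x ∈ Ico (0 : ℝ) (((n : ℝ) + 1) * h)
    · rw [indicator_of_mem (Ico_subset_Icc_self hx)]
      exact pow_le_pow_left₀ (norm_nonneg _) (norm_latticeStep_le hQ x) 2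
    · rw [latticeStep_eq_zero_of_not_mem hh hQ hx, norm_zero, zero_pow two_ne_zero]
      exact indicator_nonneg (fun _ _ => by positivity) _

/-- `∫ |latticeStep h Q|² = h · Σ_{k ≤ n} |Q_k|²`. [folklore] -/
theorem integral_norm_sq_latticeStep (hh : 0 < h) (hQ : Q.natDegree ≤ n) :
    ∫ x, ‖latticeStep h Q x‖ ^ 2 = h * ∑ k ∈ Finset.range (n + 1), ‖Q.coeff k‖ ^ 2 := by
  rw [integral_eq_sum_cells hh n (w := fun x => ‖latticeStep h Q x‖ ^ 2), Finset.mul_sum]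
  · refine Finset.sum_congr rfl fun k _ => ?_
    rw [intervalIntegral_cell_congr hh (v := fun _ => ‖Q.coeff k‖ ^ 2) fun x hx => by
      show ‖latticeStep h Q x‖ ^ 2 = ‖Q.coeff k‖ ^ 2
      rw [latticeStep_of_mem_Ico hh ⟨hx.1.le, hx.2⟩]]
    rw [intervalIntegral.integral_const, smul_eq_mul]
    ring
  · intro x hx
    rw [latticeStep_eq_zero_of_not_mem hh hQ hx, norm_zero, zero_pow two_ne_zero]
  · intro k _
    exact ((memLp_two_iff_integrable_sq_norm (measurable_latticeStep h Q).aestronglyMeasurable).mp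
      (memLp_two_latticeStep hh hQ)).intervalIntegrable

/-- The middle coefficient of the autocorrelation polynomial: `Σ_{k ≤ n} |q_k|² = Re (q * conjReverse n q)_n`.
[folklore] -/
theorem sum_norm_sq_coeff_eq_re_coeff (q : ℂ[X]) (n : ℕ) :
    ∑ k ∈ Finset.range (n + 1), ‖q.coeff k‖ ^ 2 = ((q * conjReverse n q).coeff n).re := by
  rw [coeff_mul, Finset.Nat.sum_antidiagonal_eq_sum_range_succ
    (fun a b => q.coeff a * (conjReverse n q).coeff b) n, Complex.re_sum]
  refine Finset.sum_congr rfl fun k hk => ?_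
  have hkn : k ≤ n := Nat.lt_succ_iff.mp (Finset.mem_range.mp hk)
  rw [coeff_conjReverse q (Nat.sub_le n k), Nat.sub_sub_self hkn, mul_conj, ofReal_re, normSq_eq_norm_sq]

/-! ## Sampling a compactly supported function -/

/-- Coefficients of the sampling polynomial: `g(kh)` for `k ≤ n`. [folklore] -/
theorem coeff_samplePoly_of_le {k : ℕ} (hk : k ≤ n) (g : ℝ → ℂ) : (samplePoly h n g).coeff k = g (k * h) := by
  unfold samplePoly
  rw [finsetSum_coeff, Finset.sum_eq_single k]
  · rw [coeff_C_mul_X_pow, if_pos rfl]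
  · intro i _ hik; rw [coeff_C_mul_X_pow, if_neg (Ne.symm hik)]
  · intro hk'; exact absurd (Finset.mem_range.mpr (Nat.lt_succ_of_le hk)) hk'

/-- The lattice step function of the sampling polynomial of a `g` vanishing right of `L < (n+1)h` is the
left-endpoint sample `g(⌊x/h⌋ h)` on `x ≥ 0`. [folklore] -/
theorem latticeStep_samplePoly (hh : 0 < h) {L : ℝ} {g : ℝ → ℂ} (hgL : ∀ x, L < x → g x = 0)
    (hn : L < ((n : ℝ) + 1) * h) {x : ℝ} (hx : 0 ≤ x) :
    latticeStep h (samplePoly h n g) x = g (⌊x / h⌋₊ * h) := by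
  simp only [latticeStep, if_pos hx]
  by_cases hk : ⌊x / h⌋₊ ≤ n
  · exact coeff_samplePoly_of_le hk g
  · rw [coeff_eq_zero_of_natDegree_lt (lt_of_le_of_lt (natDegree_samplePoly_le h n g) (not_le.mp hk)),
      hgL]
    refine hn.trans_le ?_
    have : (n : ℝ) + 1 ≤ ⌊x / h⌋₊ := by exact_mod_cast (not_le.mp hk)
    nlinarith

/-- **Uniform approximation by sampling.** If `g` vanishes off `[0, L]`, `L < (n+1)h`, and
`|g x - g y| ≤ ε` whenever `|x - y| ≤ h`, then `latticeStep h (samplePoly h n g)` is uniformly `ε`-close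
to `g`. [folklore] -/
theorem norm_latticeStep_samplePoly_sub_le (hh : 0 < h) {L : ℝ} {g : ℝ → ℂ} (hg0 : ∀ x, x < 0 → g x = 0)
    (hgL : ∀ x, L < x → g x = 0) (hn : L < ((n : ℝ) + 1) * h) {ε : ℝ}
    (hmod : ∀ x y : ℝ, |x - y| ≤ h → ‖g x - g y‖ ≤ ε) (x : ℝ) :
    ‖latticeStep h (samplePoly h n g) x - g x‖ ≤ ε := by
  rcases lt_or_ge x 0 with hx | hx
  · rw [latticeStep_of_neg hx, hg0 x hx, sub_zero, norm_zero]
    exact le_trans (norm_nonneg _) (hmod 0 0 (by simp [hh.le]))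
  · rw [latticeStep_samplePoly hh hgL hn hx]
    refine hmod _ _ ?_
    have h1 : (⌊x / h⌋₊ : ℝ) * h ≤ x := by rw [← le_div_iff₀ hh]; exact Nat.floor_le (div_nonneg hx hh.le)
    have h2 : x < ((⌊x / h⌋₊ : ℝ) + 1) * h := by rw [← div_lt_iff₀ hh]; exact Nat.lt_floor_add_one _
    rw [abs_le]; constructor <;> nlinarith

/-- Fourier transforms of two functions that vanish off `[0, T]` and are uniformly `ε`-close are
`ε·T`-close. [folklore] -/
theorem norm_fourier_sub_fourier_le {u v : ℝ → ℂ} (hu : Integrable u) (hv : Integrable v) {T ε : ℝ}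
    (hT : 0 ≤ T) (hu0 : ∀ x ∉ Icc 0 T, u x = 0) (hv0 : ∀ x ∉ Icc 0 T, v x = 0)
    (hε : ∀ x, ‖u x - v x‖ ≤ ε) (ξ : ℝ) : ‖𝓕 u ξ - 𝓕 v ξ‖ ≤ ε * T := by
  have hε0 : 0 ≤ ε := le_trans (norm_nonneg _) (hε 0)
  rw [Real.fourier_eq, Real.fourier_eq, ← integral_sub ((Real.fourierIntegral_convergent_iff ξ).2 hu)
    ((Real.fourierIntegral_convergent_iff ξ).2 hv)]
  simp_rw [← smul_sub]
  calc ‖∫ x, 𝐞 (-(inner ℝ x ξ)) • (u x - v x)‖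
      ≤ ∫ x, (Icc 0 T).indicator (fun _ => ε) x := by
        refine norm_integral_le_of_norm_le
          ((integrableOn_const (measure_Icc_lt_top.ne)).integrable_indicator measurableSet_Icc)
          (Eventually.of_forall fun x => ?_)
        rw [Circle.norm_smul]
        by_cases hx : x ∈ Icc 0 T
        · rw [indicator_of_mem hx]; exact hε x
        · rw [indicator_of_notMem hx, (hu0 x hx), (hv0 x hx), sub_zero, norm_zero]
    _ = ε * T := by
        rw [integral_indicator measurableSet_Icc, setIntegral_const, Real.volume_real_Icc_of_le hT, sub_zero,
          smul_eq_mul, mul_comm]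

end Literature.Analysis.Fourier.LatticeStep

end
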